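import Literature.Computability.QuantumComplexity.GRBlockWord
import Literature.Computability.QuantumComplexity.GenKit
import HarnessLib

/-!
# The concrete Grover–Rudolph block: layout and the `Data` of `GRBlockWord`

Topic `Literature/Computability/QuantumComplexity`; sequel of `GRBlockWord.lean` (the block over abstract
per-level `Data`) and `GenKit.lean` (a gadget kit inside a block of data wires). The block register of
one coordinate of Regev's sampler (Lemma 3.12/3.14) has `ℓ + wlen` data wires — the point register
`ws j = wire j` (`j < ℓ`) and the work window `[ℓ, ℓ + wlen)` of the cosine machine — followed by the
kit of the single level program `GRWord.prog kk`; between the point wires and the window sit `np`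
PARAMETER wires `pw t = wire (ℓ + t)` holding the instance parameters the cosine machine reads (on wires,
not in the circuit, for uniformity). Given the machine data (`GRData.Mach`: machine, suffixes, output
words with `MachOK` on `j + np` data bits, the window and read-out bounds, and the field specification on
prefix-plus-parameter words) this file discharges every GEOMETRIC field of `GRBlock.Data`:

* `GRData.kit`, `GRData.ws`, `GRData.pw`, `dataOf_eq` (the data word of level `j` is the prefix followed
  by the parameter word), `conjGeom` (`ConjGeom` with base `ℓ + np`), `wiresOK`, `progOK`, `ws_off`,
  `ws_kit`, and **`GRData.data`** `: GRBlock.Data (kit ℓ np wlen kk) (ws ℓ np wlen kk) (pw ℓ np wlen kk) a`.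

Everything here is proved; definitions have bodies; no named fact is introduced.

## References

* O. Regev, J. ACM 56 (2009), art. 34, Lemma 3.12 (proof), Lemma 3.14 (proof) [Regev2009].
* M. A. Nielsen, I. L. Chuang, *Quantum Computation and Quantum Information*, CUP 2010, §3.2.5 [NielsenChuang2010].
-/

noncomputable section

namespace Literature.Computability.QuantumComplexity

open Literature.Computability.Complexity (bitsToNat)
open Cryptography RevSim RevClean GadgetKit GRWord Complexity.FinTM2Sim Turing

namespace GRData

variable (ℓ np wlen kk : ℕ)

/-- The program list of the block: the single level program. [folklore] -/
def ps (kk : ℕ) : List SLP.BExpr := [GRWord.prog kk]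

/-- The block size. [folklore] -/
abbrev B : ℕ := GenKit.bsize (ps kk) (ℓ + np + wlen) kk

/-- **The kit of the block.** [folklore] -/
def kit : GadgetKit (B ℓ np wlen kk) := GenKit.kit (ps kk) (ℓ + np + wlen) kk

/-- The kit is the generic kit (definitional). [folklore] -/
theorem kit_eq : kit ℓ np wlen kk = GenKit.kit (ps kk) (ℓ + np + wlen) kk := rfl

/-- Data wire `m < ℓ + np + wlen` of the block. [folklore] -/
def dw (m : Fin (ℓ + np + wlen)) : Fin (B ℓ np wlen kk) := GenKit.dataEmb (ps kk) (ℓ + np + wlen) kk m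

/-- Values of data wires. [folklore] -/
theorem dw_val (m : Fin (ℓ + np + wlen)) : (dw ℓ np wlen kk m : ℕ) = m := GenKit.dataEmb_val _ _ _ _

/-- Data wires are injective. [folklore] -/
theorem dw_injective : Function.Injective (dw ℓ np wlen kk) := (GenKit.dataEmb (ps kk) (ℓ + np + wlen) kk).injective

/-- **The point register**: data wires `0, …, ℓ−1`. [cite: Regev2009, Lemma 3.12 (proof)] -/
def ws : Fin ℓ ↪ Fin (B ℓ np wlen kk) :=
  ⟨fun j => dw ℓ np wlen kk ⟨j, by omega⟩, fun j j' h => Fin.ext (by simpa using congrArg Fin.val (dw_injective ℓ np wlen kk h))⟩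

/-- **The parameter wires**: data wires `ℓ, …, ℓ+np−1`. [folklore] -/
def pw : Fin np ↪ Fin (B ℓ np wlen kk) :=
  ⟨fun t => dw ℓ np wlen kk ⟨ℓ + t, by omega⟩, fun t t' h => Fin.ext (by simpa using congrArg Fin.val (dw_injective ℓ np wlen kk h))⟩

/-- Values of the point wires. [folklore] -/
theorem ws_val (j : Fin ℓ) : (ws ℓ np wlen kk j : ℕ) = j := dw_val _ _ _ _ _

/-- Values of the parameter wires. [folklore] -/
theorem pw_val (t : Fin np) : (pw ℓ np wlen kk t : ℕ) = ℓ + t := dw_val _ _ _ _ _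

/-- The prefix positions are the identity below `ℓ`. [folklore] -/
theorem dposOf_ws {i : ℕ} (hi : i < ℓ) : GRBlock.dposOf (ws ℓ np wlen kk) i = i := by
  unfold GRBlock.dposOf; rw [dif_pos hi]; exact ws_val ℓ np wlen kk ⟨i, hi⟩

/-- **The data positions of level `j`**: `i < j ↦ i`, `j ≤ i < j + np ↦ ℓ + (i − j)`. [folklore] -/
theorem dposP_eq {j i : ℕ} (hj : j ≤ ℓ) (hi : i < j + np) :
    GRBlock.dposP (ws ℓ np wlen kk) (pw ℓ np wlen kk) j i = if i < j then i else ℓ + (i - j) := by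
  by_cases h : i < j
  · rw [if_pos h, GRBlock.dposP_of_lt _ _ h, dposOf_ws ℓ np wlen kk (by omega)]
  · rw [if_neg h]
    have ht : i - j < np := by omega
    have := GRBlock.dposP_param (ws ℓ np wlen kk) (pw ℓ np wlen kk) j ⟨i - j, ht⟩
    rw [show j + (i - j) = i by omega] at this
    rw [this, pw_val]

/-- A wire with value below `ℓ + np + wlen` is a data wire. [folklore] -/
theorem eq_dw_of_val {x : Fin (B ℓ np wlen kk)} {m : ℕ} (hm : m < ℓ + np + wlen) (hx : (x : ℕ) = m) : x = dw ℓ np wlen kk ⟨m, hm⟩ :=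
  Fin.ext (by rw [hx, dw_val])

/-- `finOf` of a small value is the data wire. [folklore] -/
theorem finOf_eq_dw {m : ℕ} (hm : m < ℓ + np + wlen) (h0 : 0 < B ℓ np wlen kk) : finOf (B ℓ np wlen kk) h0 m = dw ℓ np wlen kk ⟨m, hm⟩ :=
  eq_dw_of_val ℓ np wlen kk hm (val_finOf_of_lt h0 (by unfold B GenKit.bsize GenKit.rb GenKit.dataOff; omega))

/-- **The data word of level `j`** is the prefix of the point register followed by the parameter word. [folklore] -/
theorem dataOf_eq (j : Fin ℓ) (z : QReg (B ℓ np wlen kk)) :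
    dataOf (kit := kit ℓ np wlen kk) (j + np) (GRBlock.dposP (ws ℓ np wlen kk) (pw ℓ np wlen kk) j) z =
      (List.ofFn fun i : Fin j => (z ∘ ws ℓ np wlen kk) ⟨i, lt_of_lt_of_le i.2 (le_of_lt j.2)⟩) ++ List.ofFn (z ∘ pw ℓ np wlen kk) := by
  unfold dataOf
  apply List.ext_getElem (by simp)
  intro i h₁ h₂
  rw [List.length_ofFn] at h₁
  rw [List.getElem_ofFn, List.getElem_append]
  have hB : 0 < B ℓ np wlen kk := (kit ℓ np wlen kk).hN
  simp only [List.length_ofFn]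
  by_cases hi : i < j
  · rw [dif_pos hi, List.getElem_ofFn]
    simp only [Function.comp_apply]
    congr 1
    show finOf (B ℓ np wlen kk) (kit ℓ np wlen kk).hN (GRBlock.dposP (ws ℓ np wlen kk) (pw ℓ np wlen kk) j i) = _
    rw [dposP_eq ℓ np wlen kk (le_of_lt j.2) h₁, if_pos hi, finOf_eq_dw ℓ np wlen kk (by omega)]
    rfl
  · rw [dif_neg hi, List.getElem_ofFn]
    simp only [Function.comp_apply]
    congr 1
    show finOf (B ℓ np wlen kk) (kit ℓ np wlen kk).hN (GRBlock.dposP (ws ℓ np wlen kk) (pw ℓ np wlen kk) j i) = _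
    rw [dposP_eq ℓ np wlen kk (le_of_lt j.2) h₁, if_neg hi, finOf_eq_dw ℓ np wlen kk (by omega)]
    show dw ℓ np wlen kk ⟨ℓ + (i - j), _⟩ = dw ℓ np wlen kk ⟨ℓ + (i - j), _⟩
    rfl

/-! ### The machine data -/

/-- **The machine data of the block**: the cosine machine, its suffixes and output words, with the
machine hypothesis of every level (on `j + np` data bits), the window and read-out bounds and the field
specification on prefix-plus-parameter words for the parameter content `c`. [cite: Regev2009, Lemma 3.12 (proof)] -/
structure Mach (a : Fin ℓ → (Fin ℓ → Bool) → ℝ) where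
  /-- time exponent -/
  e : ℕ
  /-- the machine -/
  M : TM2ComputableAux Bool Bool
  /-- suffixes -/
  v : Fin ℓ → List Bool
  /-- output words -/
  fbits : Fin ℓ → List Bool → List Bool
  /-- the parameter word -/
  c : Fin np → Bool
  /-- the machine hypothesis, on data words whose parameter part is `c` -/
  hM : ∀ j : Fin ℓ, MachOK (kit ℓ np wlen kk) e M (j + np) (v j) (fun d => d.drop j = List.ofFn c) (fbits j)
  /-- the block of level `j` fits in the window -/
  width_le : ∀ j : Fin ℓ, width e M (j + np + (v j).length) ≤ j + np + wlen
  /-- the field cells fit in the read-out zone -/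
  k_le : ∀ j : Fin ℓ, kk ≤ JJ e M (j + np + (v j).length)
  /-- **the field specification** on prefix-plus-parameter words -/
  spec : ∀ (j : Fin ℓ) (y : Fin ℓ → Bool),
    SLP.aTil kk (bitsToNat (fbits j ((List.ofFn fun i : Fin j => y ⟨i, lt_of_lt_of_le i.2 (le_of_lt j.2)⟩) ++ List.ofFn c))) = a j y

variable {ℓ np wlen kk} {a : Fin ℓ → (Fin ℓ → Bool) → ℝ} (m : Mach ℓ np wlen kk a) (hk1 : 1 ≤ kk)

/-- The top of every level's window is at most `ℓ + np + wlen`. [folklore] -/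
theorem top_le (j : Fin ℓ) : CleanPlaced.top m.e m.M (j + np) (m.v j) (ℓ + np) ≤ ℓ + np + wlen := by
  have := m.width_le j; unfold CleanPlaced.top; omega

include hk1 in
/-- Every kit wire is at or above `ℓ + np + wlen`. [folklore] -/
theorem le_of_mem_kit {x : Fin (B ℓ np wlen kk)}
    (hx : x ∈ (kit ℓ np wlen kk).cr :: (kit ℓ np wlen kk).as ++ (kit ℓ np wlen kk).region ++ (kit ℓ np wlen kk).hs) : ℓ + np + wlen ≤ (x : ℕ) := by
  have hkOK : (kit ℓ np wlen kk).OK := GenKit.kit_ok _ _ _ hk1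
  rw [List.mem_append, List.cons_append, List.mem_cons, List.mem_append] at hx
  rcases hx with (rfl | hx | hx) | hx
  · rw [kit_eq, GenKit.kit_cr, GenKit.wire_val _ _ _ (by unfold GenKit.bsize GenKit.rb GenKit.dataOff; omega)]
    unfold GenKit.dataOff; omega
  · rw [kit_eq, GenKit.kit_as, List.mem_map] at hx
    obtain ⟨i, hi, rfl⟩ := hx
    rw [List.mem_range] at hi
    rw [GenKit.wire_val _ _ _ (by unfold GenKit.bsize GenKit.rb GenKit.dataOff; omega)]
    unfold GenKit.dataOff; omega
  · have := GadgetKit.region_val hkOK x hx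
    rw [kit_eq, GenKit.kit_rb] at this
    unfold GenKit.rb GenKit.dataOff at this; omega
  · rw [kit_eq, GenKit.kit_hs, List.mem_map] at hx
    obtain ⟨i, hi, rfl⟩ := hx
    rw [List.mem_range] at hi
    rw [GenKit.wire_val _ _ _ (by unfold B GenKit.bsize GenKit.rb GenKit.dataOff GenKit.regionSize at *; omega)]
    unfold GenKit.dataOff; omega

include hk1 in
/-- **The geometry of level `j`.** [folklore] -/
theorem conjGeom (j : Fin ℓ) :
    ConjGeom (kit ℓ np wlen kk) (ws ℓ np wlen kk j) m.e m.M (j + np) (m.v j) (GRBlock.dposP (ws ℓ np wlen kk) (pw ℓ np wlen kk) j) (ℓ + np) := by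
  have htop := top_le m j
  have hB : ℓ + np + wlen ≤ B ℓ np wlen kk := by unfold B GenKit.bsize GenKit.rb GenKit.dataOff; omega
  have hd : ∀ i, i < j + np → GRBlock.dposP (ws ℓ np wlen kk) (pw ℓ np wlen kk) j i = if i < j then i else ℓ + (i - j) :=
    fun i hi => dposP_eq ℓ np wlen kk (le_of_lt j.2) hi
  refine
    { geom :=
        { inj := fun i i' hi hi' h => by
            rw [hd i hi, hd i' hi'] at h
            split_ifs at h <;> omega
          lt := fun i hi => by rw [hd i hi]; split_ifs <;> omega
          top_le := htop.trans hB }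
      t_dpos := fun i hi => by rw [ws_val, hd i hi]; split_ifs <;> omega
      t_lt := by rw [ws_val]; omega
      kit_off := fun x hx => ?_
      k_le := m.k_le j }
  have hval := le_of_mem_kit hk1 hx
  exact ⟨Or.inr (htop.trans hval), fun i hi h => by rw [hd i hi] at h; split_ifs at h <;> omega⟩

include hk1 in
/-- **The wires of level `j` are well placed.** [folklore] -/
theorem wiresOK (j : Fin ℓ) : WiresOK (kit ℓ np wlen kk) (ws ℓ np wlen kk j) (fsEmb (conjGeom m hk1 j)) := by
  have hG := conjGeom m hk1 j
  have htop := top_le m j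
  have hfs : ∀ b : Fin kk, ∃ (w : ℕ) (hw : ℓ + np + w < ℓ + np + wlen), (j : ℕ) < ℓ + np + w ∧
      fsEmb hG b = dw ℓ np wlen kk ⟨ℓ + np + w, hw⟩ := by
    intro b
    have hwin := fsW_window hG b.2
    refine ⟨resW m.e m.M (j + np + (m.v j).length) b (CWrap.symTrue m.M) - (j + np), by omega, by omega, ?_⟩
    exact finOf_eq_dw ℓ np wlen kk (by omega) (kit ℓ np wlen kk).hN
  have hdf := fun i : Fin (ℓ + np + wlen) => GenKit.data_facts (ps kk) (ℓ + np + wlen) kk i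
  have ht : ws ℓ np wlen kk j = dw ℓ np wlen kk ⟨j, by omega⟩ := rfl
  refine
    { t_lt := by rw [ht]; exact (hdf _).1
      fs_lt := fun b => by obtain ⟨w, hw, -, e⟩ := hfs b; rw [e]; exact (hdf _).1
      t_had := by rw [ht]; exact (hdf _).2.2.1
      fs_had := fun b => by obtain ⟨w, hw, -, e⟩ := hfs b; rw [e]; exact (hdf _).2.2.1
      t_hs := by rw [ht]; exact (hdf _).2.2.2
      fs_hs := fun b => by obtain ⟨w, hw, -, e⟩ := hfs b; rw [e]; exact (hdf _).2.2.2
      t_fs := ?_ }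
  rintro ⟨b, hb⟩
  obtain ⟨w, hw, hjw, e⟩ := hfs b
  have := congrArg Fin.val hb
  rw [e, dw_val, ws_val] at this
  simp at this; omega

include hk1 in
/-- **The kit dominates the level program.** [folklore] -/
theorem progOK : ProgOK (kit ℓ np wlen kk) := by
  obtain ⟨h1, h2, h3⟩ := GenKit.bounds_of_mem (ps kk) (ℓ + np + wlen) kk (b := GRWord.prog kk) (List.mem_singleton.2 rfl)
  exact ⟨h1, h2, h3, hk1⟩

/-- The point wires are off every work window. [folklore] -/
theorem ws_off (i j : Fin ℓ) : ws ℓ np wlen kk i ∉ workWires (kit := kit ℓ np wlen kk) m.e m.M (j + np) (m.v j) (ℓ + np) := by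
  intro h
  rw [workWires, List.mem_map] at h
  obtain ⟨w, hw, e⟩ := h
  rw [List.mem_range] at hw
  have htop := top_le m j
  have := congrArg Fin.val e
  rw [val_finOf_of_lt _ (by unfold B GenKit.bsize GenKit.rb GenKit.dataOff; omega), ws_val] at this
  omega

include hk1 in
/-- The point wires are off the kit's clean wires. [folklore] -/
theorem ws_kit (i : Fin ℓ) :
    ws ℓ np wlen kk i ∉ (kit ℓ np wlen kk).cr :: (kit ℓ np wlen kk).as ++ (kit ℓ np wlen kk).region ++ (kit ℓ np wlen kk).hs := fun h => by
  have := le_of_mem_kit hk1 h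
  rw [ws_val] at this
  omega

/-- **The `Data` of the concrete Grover–Rudolph block.** [cite: Regev2009, Lemma 3.12 (proof)] -/
def data (ha : ∀ j y, |a j y| ≤ 1) (hau : ∀ j y b, a j (Function.update y j b) = a j y) :
    GRBlock.Data (kit ℓ np wlen kk) (ws ℓ np wlen kk) (pw ℓ np wlen kk) a where
  e := m.e
  M := m.M
  v := m.v
  fbits := m.fbits
  base := ℓ + np
  c := m.c
  hk := GenKit.kit_ok _ _ _ hk1
  hM := m.hM
  hG := conjGeom m hk1
  hW := wiresOK m hk1
  hP := progOK hk1
  spec j z hz := by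
    rw [dataOf_eq, show (z ∘ pw ℓ np wlen kk) = m.c from funext hz]
    exact m.spec j (z ∘ ws ℓ np wlen kk)
  a_abs := ha
  a_update := hau
  ws_off := ws_off m
  ws_kit := ws_kit hk1
  pw_ws t i h := by
    have := congrArg Fin.val h
    rw [pw_val, ws_val] at this
    omega

end GRData

end Literature.Computability.QuantumComplexity

end
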